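import Summits.HodgeConjecture.CorCM.CommonQuarticCMSubfieldSimpleFourfolds
import Summits.HodgeConjecture.CorCM.ReflexFieldsMeetRealCMHodge
import HarnessLib

/-!
# TWO-FIBRE types: a CM type which is the union of a fibre over a place of one subfield and a fibre over a place of
# another subfield is defined over the compositum of the two images — the additive half of the `(4,4)` cell over a
# common quartic CM field, up to a totally-real-intersection check

COR-CM (cell `pub-hodgecm2`, binder seat `b16` gen 49, count-neutral claim PARSHADOW, file F7; theorems only, no
definition, no named fact, no `sorry`).  NEW as stated, hence under `Summits/`.  HONEST FRAMING: the Hodge conjecture is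
obtained for NAMED products of CM abelian varieties from the tree's `ReflexFieldsMeetRealCMHodge` (fields of definition
meeting in a totally real field); `HC_CM` is neither used nor asserted.

THE OBSERVATION.  Let `K` be an octic CM field containing a quartic CM field `k` (`e : k → K`).  Then `K/k⁺` is
biquadratic and `K` contains a SECOND quartic CM field `k'` (`e' : k' → K`, `K = k k'`).  A type `Φ` of `K` with exactly
one unsplit conjugate pair `{z₁, z̄₁}` over `k` — say both extensions of `z₁` in `Φ`, and over the split pair `{z₂, z̄₂}` the
extension `x₂ ∈ Φ` of `z₂` — is the UNION OF TWO FIBRES: `Φ = {y | y ∘ e = z₁} ∪ {y | y ∘ e' = u}` with `u = x₂ ∘ e'`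
(`twoFibre_of_unsplit_of_split`; the two points over `z₂` restrict to `k'` as `u, ū`, and `\overline{x₂⁻} = (z̄₂, u)`).  Hence
(`forall_smul_mem_iff_of_smul_eq_of_twoFibre`) every automorphism of `ℂ` fixing the places `z₁` and `u` stabilises `Φ`:
**`E = z₁(k) · u(k')` is a field of definition of `Φ`** (it is in fact the reflex field: `k⁺(√Δ₁, √(Δ₂ d₂))` in the
coordinates `k = k⁺(√Δ)`, `K⁺ = k⁺(√d)`).

THE ADDITIVE HALF (`hodgeConjectureFor_prod_of_twoFibre`).  For two slots with two-fibre types and fields of definition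
`E₀ = z₁(k₀)u₀(k₀')`, `E₁ = w₁(k₁)u₁(k₁')`: if `E₀ ∩ E₁` is totally real (pointwise fixed by complex conjugation) and both
types are nondegenerate, the Hodge conjecture and `B• = D•` hold on every `A₀^a × A₁^b` — UNCONDITIONALLY.  With files
F3/F4 (same unsplit place ⟹ exceptional classes) this decides the `(4,4)` cell over a common non-Galois quartic CM field
up to the field check «`E₀ ∩ E₁ ⊂ ℝ`», which fails exactly when the octic CM fields `E₀`, `E₁` share a CM subfield — by
the seat's numerics (`HOME/pub-hodgecm2-b16/lean-g49/shadow44_reflex.py`: 1952/1952 type pairs in 85 Galois models)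
exactly the non-additive configurations, all of which are again «same unsplit place over a common quartic CM subfield»
(`u₀(k₀') = u₁(k₁')`), i.e. instances of F3.

Hypotheses of §2 are stated checkably for census seats: fibres of two over `k` (`[K:ℚ] = 2[k:ℚ]`), joint injectivity of
the two restrictions (`K = k k'`), and «embeddings agreeing on one of `k, k'` agree or are conjugate on the other»
(`k ∩ k' = k⁺ = k'⁺`).

## References

* [Shimura1998] G. Shimura, *Abelian Varieties with Complex Multiplication and Modular Functions*, §8.3 (reflex field =
  fixed field of the stabiliser), §8.4 (2)(C), §18.1.
* [Gordon1999HodgeAVSurvey] B. B. Gordon, *A survey of the Hodge conjecture for abelian varieties*, §3 Theorem, 7.5–7.7,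
  10.10.
* [Lang2002] S. Lang, *Algebra*, VI §1 (Galois theory of composita).
-/

set_option autoImplicit false

noncomputable section

open scoped BigOperators
open CategoryTheory CategoryTheory.Limits NumberField NumberField.ComplexEmbedding Module

namespace Summit.HodgeConjecture.CorCM

open Literature.NumberTheory.ComplexMultiplication
open Literature.AlgebraicGeometry.Motives (AbelianVariety CMType)
open Literature.AlgebraicGeometry.HodgeTheory
open Literature.AlgebraicGeometry.ComplexMultiplication (IsCMTypeRealisation)
open Literature.AlgebraicGeometry.VanGeemen1994 (hodgeClassSpan)
open Literature.AlgebraicGeometry.Pohlmann1968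
open Literature.Barriers.HodgeConjecture (divisorClassesSpan)
open scoped Classical

/-! ### §1 Two-fibre types are defined over the compositum of the two places -/

section TwoFibre

variable {k k' K : Type} [Field k] [Field k'] [Field K]

/-- **Fixing the two places stabilises a two-fibre type.**  If `Φ ⊇ {y | y ∘ e = z₁} ∪ {y | y ∘ e' = u}` with equality
(`hcov`), then every `σ ∈ Aut(ℂ)` with `σ z₁ = z₁` and `σ u = u` satisfies `σΦ = Φ`. [cite: Shimura1998, §8.3] -/
theorem forall_smul_mem_iff_of_smul_eq_of_twoFibre (e : k →+* K) (e' : k' →+* K) (Φ : Set (K →+* ℂ))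
    {z₁ : k →+* ℂ} {u : k' →+* ℂ} (hz : ∀ y : K →+* ℂ, y.comp e = z₁ → y ∈ Φ)
    (hu : ∀ y : K →+* ℂ, y.comp e' = u → y ∈ Φ) (hcov : ∀ y ∈ Φ, y.comp e = z₁ ∨ y.comp e' = u) {σ : ℂ ≃+* ℂ}
    (hσz : σ • z₁ = z₁) (hσu : σ • u = u) : ∀ x : K →+* ℂ, σ • x ∈ Φ ↔ x ∈ Φ := by
  have hσz' : σ⁻¹ • z₁ = z₁ := by rw [inv_smul_eq_iff, hσz]
  have hσu' : σ⁻¹ • u = u := by rw [inv_smul_eq_iff, hσu]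
  intro x
  constructor
  · intro hx
    rcases hcov _ hx with h | h
    · refine hz x ?_
      have h' := congrArg (fun t => σ⁻¹ • t) h
      simp only [smul_comp_ringHom, inv_smul_smul] at h'
      rw [hσz'] at h'
      exact h'
    · refine hu x ?_
      have h' := congrArg (fun t => σ⁻¹ • t) h
      simp only [smul_comp_ringHom, inv_smul_smul] at h'
      rw [hσu'] at h'
      exact h'
  · intro hx
    rcases hcov x hx with h | h
    · exact hz _ (by rw [smul_comp_ringHom, h, hσz])
    · exact hu _ (by rw [smul_comp_ringHom, h, hσu])

variable [NumberField k] [NumberField k']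

/-- The image of an embedding of a number field is finite over `ℚ`. [folklore] -/
theorem finiteDimensional_fieldRange_toRatAlgHom {L : Type} [Field L] [NumberField L] (s : L →+* ℂ) :
    FiniteDimensional ℚ s.toRatAlgHom.fieldRange :=
  LinearEquiv.finiteDimensional (AlgEquiv.ofInjectiveField s.toRatAlgHom).toLinearEquiv

/-- An automorphism of `ℂ` fixing the image `z(k)` pointwise fixes the embedding `z`. [folklore] -/
theorem smul_eq_of_forall_mem_fieldRange {L : Type} [Field L] [NumberField L] (z : L →+* ℂ) {σ : ℂ ≃+* ℂ}
    (hσ : ∀ t : ℂ, t ∈ z.toRatAlgHom.fieldRange → σ t = t) : σ • z = z :=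
  RingHom.ext fun a => by
    rw [ringEquiv_smul_apply]
    exact hσ (z a) (AlgHom.mem_fieldRange.2 ⟨a, rfl⟩)

/-- **The compositum `z₁(k) · u(k')` is a field of definition of a two-fibre type**: every automorphism of `ℂ` fixing
`z₁(k) ⊔ u(k')` pointwise stabilises `Φ`. [cite: Shimura1998, §8.3] -/
theorem forall_smul_mem_iff_of_fix_sup_of_twoFibre (e : k →+* K) (e' : k' →+* K) (Φ : Set (K →+* ℂ))
    {z₁ : k →+* ℂ} {u : k' →+* ℂ} (hz : ∀ y : K →+* ℂ, y.comp e = z₁ → y ∈ Φ)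
    (hu : ∀ y : K →+* ℂ, y.comp e' = u → y ∈ Φ) (hcov : ∀ y ∈ Φ, y.comp e = z₁ ∨ y.comp e' = u) (σ : ℂ ≃+* ℂ)
    (hσ : ∀ t : ℂ, t ∈ z₁.toRatAlgHom.fieldRange ⊔ u.toRatAlgHom.fieldRange → σ t = t) :
    ∀ x : K →+* ℂ, σ • x ∈ Φ ↔ x ∈ Φ :=
  forall_smul_mem_iff_of_smul_eq_of_twoFibre e e' Φ hz hu hcov
    (smul_eq_of_forall_mem_fieldRange z₁ fun t ht =>
      hσ t ((le_sup_left : z₁.toRatAlgHom.fieldRange ≤ z₁.toRatAlgHom.fieldRange ⊔ u.toRatAlgHom.fieldRange) ht))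
    (smul_eq_of_forall_mem_fieldRange u fun t ht =>
      hσ t ((le_sup_right : u.toRatAlgHom.fieldRange ≤ z₁.toRatAlgHom.fieldRange ⊔ u.toRatAlgHom.fieldRange) ht))

end TwoFibre

/-! ### §2 One unsplit pair over `k` ⟹ two-fibre, through the second quartic CM subfield -/

section Structure

variable {k k' K : Type} [Field k] [NumberField k] [IsTotallyComplex k] [Field k'] [NumberField k']
  [IsTotallyComplex k'] [Field K] [NumberField K] [IsCMField K]

omit [NumberField k'] in
/-- `ū ≠ u` for a place of a totally complex field. [folklore] -/
private theorem conj_smul_ne (u : k' →+* ℂ) : (starRingAut : ℂ ≃+* ℂ) • u ≠ u := fun h =>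
  IsTotallyComplex.complexEmbedding_not_isReal u (ComplexEmbedding.isReal_iff.2 ((conj_smul_eq_conjugate u) ▸ h))

omit [NumberField k'] in
/-- **One unsplit pair over a quartic `k` makes the type two-fibre through `k'`.**  Setting: `K` a CM field quadratic over
a totally complex quartic `k` (`e`), with a second totally complex subfield `k'` (`e'`) such that the restrictions to `k`
and `k'` are jointly injective on `Hom(K, ℂ)` and embeddings with the same restriction to one of them have equal or
conjugate restrictions to the other (`K = k k'`, `k ∩ k' = k⁺`).  If both extensions of `z₁` lie in `Φ`, and over
`z₂ ∉ {z₁, z̄₁}` the type is split with `x₂ ∈ Φ`, then with `u = x₂ ∘ e'`:  every `y` with `y ∘ e' = u` lies in `Φ`, and every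
`y ∈ Φ` has `y ∘ e = z₁` or `y ∘ e' = u`. [cite: Shimura1998, §8.4 (2)(C) and §18.1] -/
theorem twoFibre_of_unsplit_of_split (e : k →+* K) (e' : k' →+* K) (hk : finrank ℚ k = 4)
    (h2 : finrank ℚ K = 2 * finrank ℚ k)
    (hinj : ∀ x y : K →+* ℂ, x.comp e = y.comp e → x.comp e' = y.comp e' → x = y)
    (hres : ∀ x y : K →+* ℂ, x.comp e' = y.comp e' →
      x.comp e = y.comp e ∨ x.comp e = (starRingAut : ℂ ≃+* ℂ) • y.comp e)
    (hres' : ∀ x y : K →+* ℂ, x.comp e = y.comp e →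
      x.comp e' = y.comp e' ∨ x.comp e' = (starRingAut : ℂ ≃+* ℂ) • y.comp e')
    (Φ : CMType K) {z₁ z₂ : k →+* ℂ} (hz₁ : ∀ y : K →+* ℂ, y.comp e = z₁ → y ∈ Φ.1) (hz₂ : z₂ ≠ z₁)
    (hz₂' : z₂ ≠ (starRingAut : ℂ ≃+* ℂ) • z₁)
    (hsplit : ¬ ∀ y y' : K →+* ℂ, y.comp e = z₂ → y'.comp e = z₂ → (y ∈ Φ.1 ↔ y' ∈ Φ.1))
    {x₂ : K →+* ℂ} (hx₂e : x₂.comp e = z₂) (hx₂Φ : x₂ ∈ Φ.1) :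
    (∀ y : K →+* ℂ, y.comp e' = x₂.comp e' → y ∈ Φ.1) ∧
      ∀ y ∈ Φ.1, y.comp e = z₁ ∨ y.comp e' = x₂.comp e' := by
  have hCM := isCMTypeWith_conj Φ
  set c : ℂ ≃+* ℂ := starRingAut with hc
  -- conjugating an embedding conjugates both restrictions
  have hce : ∀ y : K →+* ℂ, (c • y).comp e = c • y.comp e := fun y => rfl
  have hce' : ∀ y : K →+* ℂ, (c • y).comp e' = c • y.comp e' := fun y => rfl
  have hcc : ∀ w : k →+* ℂ, c • c • w = w := fun w => by
    rw [hc, conj_smul_eq_conjugate, conj_smul_eq_conjugate]; exact ComplexEmbedding.involutive_conjugate k w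
  -- the fibre claim
  have hfib : ∀ y : K →+* ℂ, y.comp e' = x₂.comp e' → y ∈ Φ.1 := by
    intro y hy
    rcases hres y x₂ hy with h | h
    · rw [hinj y x₂ h hy]; exact hx₂Φ
    · -- `y` lies over `z̄₂`; if `y ∉ Φ` then `ȳ ∈ Φ` lies over `z₂` with `k'`-restriction `ū ≠ u`: `z₂` would be unsplit
      by_contra hyΦ
      have hcy : c • y ∈ Φ.1 := (hCM.rho_smul_mem_iff y).2 hyΦ
      have hcye : (c • y).comp e = z₂ := by rw [hce, h, hx₂e, hcc]
      have hne : c • y ≠ x₂ := fun heq => by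
        have h1 : (c • y).comp e' = x₂.comp e' := by rw [heq]
        rw [hce', hy] at h1
        exact conj_smul_ne (x₂.comp e') h1
      apply hsplit
      intro w w' hw hw'
      -- the fibre over `z₂` is `{x₂, c • y}`, both in `Φ`
      have hmem : ∀ v : K →+* ℂ, v.comp e = z₂ → v ∈ Φ.1 := by
        intro v hv
        by_contra hvΦ
        have hv1 : v ≠ x₂ := fun h' => hvΦ (h' ▸ hx₂Φ)
        have hv2 : v ≠ c • y := fun h' => hvΦ (h' ▸ hcy)
        have hcard : ({x₂, c • y, v} : Finset (K →+* ℂ)).card ≤ 2 := by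
          rw [← card_filter_comp_eq_two e h2 z₂]
          refine Finset.card_le_card fun t ht => ?_
          simp only [Finset.mem_insert, Finset.mem_singleton] at ht
          simp only [Finset.mem_filter, Finset.mem_univ, true_and]
          rcases ht with rfl | rfl | rfl
          · exact hx₂e
          · exact hcye
          · exact hv
        have h3 : ({x₂, c • y, v} : Finset (K →+* ℂ)).card = 3 := by
          rw [Finset.card_insert_of_notMem, Finset.card_pair (Ne.symm hv2)]
          simp only [Finset.mem_insert, Finset.mem_singleton, not_or]
          exact ⟨Ne.symm hne, Ne.symm hv1⟩
        omega
      exact ⟨fun _ => hmem w' hw', fun _ => hmem w hw⟩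
  refine ⟨hfib, fun y hy => ?_⟩
  -- the cover: places of `k` are `z₁, z̄₁, z₂, z̄₂`
  by_cases h1 : y.comp e = z₁
  · exact Or.inl h1
  right
  by_cases h1' : y.comp e = c • z₁
  · -- over `z̄₁` nothing is in `Φ`
    exfalso
    have hcy : (c • y).comp e = z₁ := by rw [hce, h1', hcc]
    exact (hCM.rho_smul_mem_iff y).1 (hz₁ _ hcy) hy
  rcases eq_or_eq_conj_of_finrank_eq_four hk hz₂ hz₂' (y.comp e) h1 h1' with h | h
  · -- over `z₂`: `y = x₂` since `z₂` is split
    by_contra hne'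
    have hne : y ≠ x₂ := fun heq => hne' (by rw [heq])
    apply hsplit
    intro w w' hw hw'
    have hmem : ∀ v : K →+* ℂ, v.comp e = z₂ → v ∈ Φ.1 := by
      intro v hv
      by_contra hvΦ
      have hv1 : v ≠ x₂ := fun h' => hvΦ (h' ▸ hx₂Φ)
      have hv2 : v ≠ y := fun h' => hvΦ (h' ▸ hy)
      have hcard : ({x₂, y, v} : Finset (K →+* ℂ)).card ≤ 2 := by
        rw [← card_filter_comp_eq_two e h2 z₂]
        refine Finset.card_le_card fun t ht => ?_
        simp only [Finset.mem_insert, Finset.mem_singleton] at ht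
        simp only [Finset.mem_filter, Finset.mem_univ, true_and]
        rcases ht with rfl | rfl | rfl
        · exact hx₂e
        · exact h
        · exact hv
      have h3 : ({x₂, y, v} : Finset (K →+* ℂ)).card = 3 := by
        rw [Finset.card_insert_of_notMem, Finset.card_pair (Ne.symm hv2)]
        simp only [Finset.mem_insert, Finset.mem_singleton, not_or]
        exact ⟨Ne.symm hne, Ne.symm hv1⟩
      omega
    exact ⟨fun _ => hmem w' hw', fun _ => hmem w hw⟩
  · -- over `z̄₂`: `y` and `x̄₂ ∉ Φ` are the two points; their `k'`-restrictions are `u`-or-`ū` and `ū`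
    have hcx₂ : c • x₂ ∉ Φ.1 := fun h' => (hCM.rho_smul_mem_iff x₂).1 h' hx₂Φ
    have hcx₂e : (c • x₂).comp e = c • z₂ := by rw [hce, hx₂e]
    have hne : y ≠ c • x₂ := fun heq => hcx₂ (heq ▸ hy)
    rcases hres' y (c • x₂) (h.trans hcx₂e.symm) with h' | h'
    · exact absurd (hinj y (c • x₂) (h.trans hcx₂e.symm) h') hne
    · rw [h', hce']
      change c • c • x₂.comp e' = x₂.comp e'
      rw [hc, conj_smul_eq_conjugate, conj_smul_eq_conjugate]
      exact ComplexEmbedding.involutive_conjugate k' _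

end Structure

/-! ### §3 The additive half: two-fibre types with fields of definition meeting in a totally real field -/

section Additive

variable {I : Type} {K : I → Type} [∀ i, Field (K i)] [∀ i, NumberField (K i)] [∀ i, IsCMField (K i)] [Fintype I]
  [DecidableEq I] [Nonempty I] {Φ : ∀ i, CMType (K i)}
variable {A : I → AbelianVariety ℂ} {ι : ∀ i, 𝓞 (K i) →+* End (A i)}
  {θ : ∀ i, K i →+* Module.End ℂ (complexBetti (A i).X 1)}
variable {k₀ k₀' k₁ k₁' : Type} [Field k₀] [NumberField k₀] [Field k₀'] [NumberField k₀'] [Field k₁] [NumberField k₁]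
  [Field k₁'] [NumberField k₁']

/-- **The additive half.**  Two slots `i₀ ≠ i₁` (`I = {i₀, i₁}`) carrying TWO-FIBRE types — `Φ_{i₀} = {y | y∘e₀ = z₀} ∪
{y | y∘e₀' = u₀}`, `Φ_{i₁} = {y | y∘e₁ = z₁} ∪ {y | y∘e₁' = u₁}` — whose fields of definition `E₀ = z₀(k₀)u₀(k₀')`,
`E₁ = z₁(k₁)u₁(k₁')` meet in a field fixed pointwise by complex conjugation, both types nondegenerate: then the Hodge
conjecture holds on every `A_{i₀}^a × A_{i₁}^b` (every `⨁_{j<N} A_{π j}`), with `B• = D•` there — UNCONDITIONALLY.  (For two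
simple CM fourfolds over a common non-Galois quartic CM field with DIFFERENT unsplit pairs, §2 supplies the two-fibre
structure; `E₀ ∩ E₁ ⊂ ℝ` fails only when `E₀`, `E₁` share a CM subfield.) [cite: Gordon1999HodgeAVSurvey, §3 Theorem and 10.10]
[cite: Shimura1998, §8.3] -/
theorem hodgeConjectureFor_prod_of_twoFibre {i₀ i₁ : I} (h01 : i₀ ≠ i₁) (hI : ∀ j, j = i₀ ∨ j = i₁)
    (e₀ : k₀ →+* K i₀) (e₀' : k₀' →+* K i₀) (e₁ : k₁ →+* K i₁) (e₁' : k₁' →+* K i₁)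
    {z₀ : k₀ →+* ℂ} {u₀ : k₀' →+* ℂ} {z₁ : k₁ →+* ℂ} {u₁ : k₁' →+* ℂ}
    (hz₀ : ∀ y : K i₀ →+* ℂ, y.comp e₀ = z₀ → y ∈ (Φ i₀).1) (hu₀ : ∀ y : K i₀ →+* ℂ, y.comp e₀' = u₀ → y ∈ (Φ i₀).1)
    (hcov₀ : ∀ y ∈ (Φ i₀).1, y.comp e₀ = z₀ ∨ y.comp e₀' = u₀)
    (hz₁ : ∀ y : K i₁ →+* ℂ, y.comp e₁ = z₁ → y ∈ (Φ i₁).1) (hu₁ : ∀ y : K i₁ →+* ℂ, y.comp e₁' = u₁ → y ∈ (Φ i₁).1)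
    (hcov₁ : ∀ y ∈ (Φ i₁).1, y.comp e₁ = z₁ ∨ y.comp e₁' = u₁)
    (hreal : ∀ t : ℂ, t ∈ z₀.toRatAlgHom.fieldRange ⊔ u₀.toRatAlgHom.fieldRange →
      t ∈ z₁.toRatAlgHom.fieldRange ⊔ u₁.toRatAlgHom.fieldRange → starRingEnd ℂ t = t)
    (hnd : ∀ i, IsNondegenerate (Φ i)) (hA : ∀ i, IsCMTypeRealisation (Φ i) (A i) (ι i) (θ i)) {N : ℕ}
    (π : Fin N → I) :
    HodgeConjectureFor (⨁ fun j : Fin N => A (π j)).dim (⨁ fun j : Fin N => A (π j)).X ∧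
      ∀ m : ℕ, hodgeClassSpan (⨁ fun j : Fin N => A (π j)).dim (⨁ fun j : Fin N => A (π j)).X m =
        divisorClassesSpan (⨁ fun j : Fin N => A (π j)).X (⨁ fun j : Fin N => A (π j)).dim m := by
  haveI := finiteDimensional_fieldRange_toRatAlgHom z₀
  haveI := finiteDimensional_fieldRange_toRatAlgHom u₀
  haveI := finiteDimensional_fieldRange_toRatAlgHom z₁
  haveI := finiteDimensional_fieldRange_toRatAlgHom u₁
  exact hodgeConjectureFor_prod_of_fixingFields_inf_real h01 hI
    (z₀.toRatAlgHom.fieldRange ⊔ u₀.toRatAlgHom.fieldRange) (z₁.toRatAlgHom.fieldRange ⊔ u₁.toRatAlgHom.fieldRange)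
    (fun σ hσ => forall_smul_mem_iff_of_fix_sup_of_twoFibre e₀ e₀' (Φ i₀).1 hz₀ hu₀ hcov₀ σ hσ)
    (fun σ hσ => forall_smul_mem_iff_of_fix_sup_of_twoFibre e₁ e₁' (Φ i₁).1 hz₁ hu₁ hcov₁ σ hσ) hreal hnd hA π

/-- **… and no exceptional Hodge class on any `A_{i₀}^a × A_{i₁}^b`** under the same hypotheses.
[cite: Gordon1999HodgeAVSurvey, 7.5 and 7.6.1] -/
theorem not_exists_exceptional_prod_of_twoFibre {i₀ i₁ : I} (h01 : i₀ ≠ i₁) (hI : ∀ j, j = i₀ ∨ j = i₁)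
    (e₀ : k₀ →+* K i₀) (e₀' : k₀' →+* K i₀) (e₁ : k₁ →+* K i₁) (e₁' : k₁' →+* K i₁)
    {z₀ : k₀ →+* ℂ} {u₀ : k₀' →+* ℂ} {z₁ : k₁ →+* ℂ} {u₁ : k₁' →+* ℂ}
    (hz₀ : ∀ y : K i₀ →+* ℂ, y.comp e₀ = z₀ → y ∈ (Φ i₀).1) (hu₀ : ∀ y : K i₀ →+* ℂ, y.comp e₀' = u₀ → y ∈ (Φ i₀).1)
    (hcov₀ : ∀ y ∈ (Φ i₀).1, y.comp e₀ = z₀ ∨ y.comp e₀' = u₀)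
    (hz₁ : ∀ y : K i₁ →+* ℂ, y.comp e₁ = z₁ → y ∈ (Φ i₁).1) (hu₁ : ∀ y : K i₁ →+* ℂ, y.comp e₁' = u₁ → y ∈ (Φ i₁).1)
    (hcov₁ : ∀ y ∈ (Φ i₁).1, y.comp e₁ = z₁ ∨ y.comp e₁' = u₁)
    (hreal : ∀ t : ℂ, t ∈ z₀.toRatAlgHom.fieldRange ⊔ u₀.toRatAlgHom.fieldRange →
      t ∈ z₁.toRatAlgHom.fieldRange ⊔ u₁.toRatAlgHom.fieldRange → starRingEnd ℂ t = t)
    (hnd : ∀ i, IsNondegenerate (Φ i)) (hA : ∀ i, IsCMTypeRealisation (Φ i) (A i) (ι i) (θ i)) {N : ℕ}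
    (π : Fin N → I) (m : ℕ) :
    ¬∃ c : complexBetti (⨁ fun j : Fin N => A (π j)).X (2 * m), IsRationalClass c ∧
        IsOfHodgeType (⨁ fun j : Fin N => A (π j)).dim (⨁ fun j : Fin N => A (π j)).X (2 * m) m m c ∧
        c ∉ divisorClassesSpan (⨁ fun j : Fin N => A (π j)).X (⨁ fun j : Fin N => A (π j)).dim m := by
  haveI := finiteDimensional_fieldRange_toRatAlgHom z₀
  haveI := finiteDimensional_fieldRange_toRatAlgHom u₀
  haveI := finiteDimensional_fieldRange_toRatAlgHom z₁
  haveI := finiteDimensional_fieldRange_toRatAlgHom u₁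
  exact not_exists_exceptional_prod_of_fixingFields_inf_real h01 hI
    (z₀.toRatAlgHom.fieldRange ⊔ u₀.toRatAlgHom.fieldRange) (z₁.toRatAlgHom.fieldRange ⊔ u₁.toRatAlgHom.fieldRange)
    (fun σ hσ => forall_smul_mem_iff_of_fix_sup_of_twoFibre e₀ e₀' (Φ i₀).1 hz₀ hu₀ hcov₀ σ hσ)
    (fun σ hσ => forall_smul_mem_iff_of_fix_sup_of_twoFibre e₁ e₁' (Φ i₁).1 hz₁ hu₁ hcov₁ σ hσ) hreal hnd hA π m

end Additive

end Summit.HodgeConjecture.CorCM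

end
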